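import Literature.AlgebraicGeometry.AbelianSchemes.AbelianSchemeQuotientDualPairRigidified
import Literature.AlgebraicGeometry.AbelianSchemes.AbelianSchemeDualIsogeny
import HarnessLib

/-!
# `ψ̂ = π^∨`: the dual-side quotient map IS the dual isogeny of `π : A/K → A` (HECKE-LINK H2, consistency export for H2c)

Layer `Literature/AlgebraicGeometry/AbelianSchemes`, namespace `Literature.AlgebraicGeometry.AbelianSchemes.AbelianSchemeOver`.
Cell `hodgecm-mathlib`, HECKE-LINK line card v1.2 §1, over ★ `AbelianSchemeQuotientDualPairRigidified` (p746606, B-p16 (g13): the dual pair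
`dualPairOfQuotientRigidified … Φ h4` of `B := A/K` with `hat := Â/K′`, `P := 𝒫_B^{rig}`, and `(B ◁ ψ̂)^*𝒫_B^{rig} ≅ 𝒩₁`) and ★
`AbelianSchemeDualIsogeny` (p745813: `dualIsogeny`, `eq_dualIsogeny`).  [MumfordAV1970] §15 Thm. 1 (p. 143): with `π : B → A` the
descended isogeny (`ψ ≫ π = [n]`), the quotient map `ψ̂ : Â → Â/K′ = B̂` is the DUAL `π^∨` of `π` for the dual pairs `(B̂, 𝒫_B^{rig})`
and `(Â, 𝒫)`: both classify the family `𝒩₁ = (π × 1)^*𝒫` on `B` parametrised by `Â` (★ `eq_dualIsogeny`).  This is the identity the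
Hecke-link's polarisation formula `ψ ≫ λ_B ≫ ψ^∨ = λ ≫ [n]` starts from (`ψ ≫ λ_B = λ ≫ ψ̂` ★ `quotientMk_comp_polarizationDesc`, then
`ψ̂ ≫ ψ^∨ = π^∨ ≫ ψ^∨ = (ψ ≫ π)^∨ = [n]^∨`).  THEOREMS ONLY; no definition, no instance, no sorry.  HC_CM is proved only modulo the
7 printed citations until rung 0 closes; nothing here is about HC.

## References
* [MumfordAV1970] D. Mumford, *Abelian Varieties* (1970), §15 Thm. 1 (p. 143).
* [MilneAV2008] J. S. Milne, *Abelian Varieties* (2008), I §8 pp. 36–37, I §9 (p. 42).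
-/

noncomputable section

universe u

open CategoryTheory CategoryTheory.Limits AlgebraicGeometry MonoidalCategory CartesianMonoidalCategory
open scoped MonObj

namespace Literature.AlgebraicGeometry.AbelianSchemes

namespace AbelianSchemeOver

open Literature.AlgebraicGeometry.RelativeSpec Literature.AlgebraicGeometry.AbelianVarieties
  Literature.AlgebraicGeometry.Motives Literature.AlgebraicGeometry.Modules

variable {S : Scheme.{u}} (A : AbelianSchemeOver S)
  {Y : Scheme.{u}} (u : S ⟶ Y) (K : Subgroup A.Sections) [IsCommMonObj A.X] {n : ℕ}
  (hK : ∀ σ : K, (σ : A.Sections) ^ n = 1)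
  [Finite K] [Y.IsSeparated] [IsSeparated (A.X.hom ≫ u)] [S.IsSeparated]
  (hcov : ∀ x : A.left, ∃ O : (A.translationActionOver u K).StableAffineOpens, x ∈ O.1)
  [LocallyOfFiniteType (A.X.hom ≫ u)] [IsLocallyNoetherian Y]
  (hG : ∃ _ : GrpObj (A.quotientOver u K), IsMonHom (A.quotientMk u K hcov))
  (hsm : Smooth (A.quotientOver u K).hom) (hgc : GeometricallyConnected (A.quotientOver u K).hom)
  (D : A.DualPair) [IsAffine Y]
  (hfree : ∀ (Ω : Type u) [Field Ω] [IsAlgClosed Ω] (x : Spec (.of Ω) ⟶ A.left) (σ : K), σ ≠ 1 →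
    x ≫ (A.translation (σ : A.Sections)).left ≠ x)
  (K' : Subgroup D.hat.Sections) [Finite K'] [IsSeparated (D.hat.X.hom ≫ u)]
  (hcov' : ∀ x : D.hat.left, ∃ O : (D.hat.translationActionOver u K').StableAffineOpens, x ∈ O.1)
  [LocallyOfFiniteType (D.hat.X.hom ≫ u)]
  (hG' : ∃ _ : GrpObj (D.hat.quotientOver u K'), IsMonHom (D.hat.quotientMk u K' hcov'))
  (hsm' : Smooth (D.hat.quotientOver u K').hom) (hgc' : GeometricallyConnected (D.hat.quotientOver u K').hom)
  (hfree' : ∀ (Ω : Type u) [Field Ω] [IsAlgClosed Ω] (x : Spec (.of Ω) ⟶ D.hat.left) (σ : K'), σ ≠ 1 →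
    x ≫ (D.hat.translation (σ : D.hat.Sections)).left ≠ x)
  (Φ : (prodTranslationActionOver (A.quotientBy u K hcov hG hsm hgc) D.hat u K' hcov').EquivariantStructure
    (A.poincarePullback u K hK hcov hG hsm hgc D hfree))

omit [IsCommMonObj A.X] [Finite K] [IsSeparated (A.X.hom ≫ u)] [LocallyOfFiniteType (A.X.hom ≫ u)] [IsAffine Y] in
/-- `1_B × ψ̂ = B ◁ ψ̂` on underlying maps: the base-change-to-product map of ★ `DualPair` along the section-free
morphism `ψ̂.left` is the whiskering. [cite: MilneAV2008, I §8 pp. 36–37] -/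
theorem baseChangeToProd_quotientMk_left_eq_whiskerLeft_left (B : AbelianSchemeOver S) :
    B.baseChangeToProd (D.hat.quotientBy u K' hcov' hG' hsm' hgc') D.hat.X.hom (D.hat.quotientMk u K' hcov').left
        (Over.w (D.hat.quotientMk u K' hcov')) =
      (B.X ◁ (show D.hat.X ⟶ (D.hat.quotientBy u K' hcov' hG' hsm' hgc').X from D.hat.quotientMk u K' hcov')).left := by
  apply pullback.hom_ext
  · exact (B.baseChangeToProd_fst (D.hat.quotientBy u K' hcov' hG' hsm' hgc') D.hat.X.hom _ _).trans
      (Over.whiskerLeft_left_fst (R := B.X)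
        (show D.hat.X ⟶ (D.hat.quotientBy u K' hcov' hG' hsm' hgc').X from D.hat.quotientMk u K' hcov')).symm
  · exact (B.baseChangeToProd_snd (D.hat.quotientBy u K' hcov' hG' hsm' hgc') D.hat.X.hom _ _).trans
      (Over.whiskerLeft_left_snd (R := B.X)
        (show D.hat.X ⟶ (D.hat.quotientBy u K' hcov' hG' hsm' hgc').X from D.hat.quotientMk u K' hcov')).symm

/-- **`ψ̂ = π^∨`**: the quotient map `Â → Â/K′` is the dual isogeny of `π : A/K → A` for the dual pairs
`dualPairOfQuotientRigidified … Φ h4` and `D` — both classify `𝒩₁ = (π × 1)^*𝒫` (★ `eq_dualIsogeny` +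
★ `nonempty_pullback_whiskerLeft_poincareQuotRigid_iso`). [cite: MumfordAV1970, §15 Thm. 1 (p. 143)]
[cite: MilneAV2008, I §9 Thm. 9.1 (p. 42)] -/
theorem quotientMk_left_eq_dualIsogeny_mulNDesc (h4) :
    (D.hat.quotientMk u K' hcov').left =
      @DualPair.dualIsogeny S (A.quotientBy u K hcov hG hsm hgc) A (A.mulNDesc u K hK hcov)
        (A.isMonHom_mulNDesc u K hK hcov hG hsm hgc hfree)
        (A.dualPairOfQuotientRigidified u K hK hcov hG hsm hgc D hfree K' hcov' hG' hsm' hgc' hfree' Φ h4) D := by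
  refine @DualPair.eq_dualIsogeny S (A.quotientBy u K hcov hG hsm hgc) A (A.mulNDesc u K hK hcov)
    (A.isMonHom_mulNDesc u K hK hcov hG hsm hgc hfree)
    (A.dualPairOfQuotientRigidified u K hK hcov hG hsm hgc D hfree K' hcov' hG' hsm' hgc' hfree' Φ h4) D
    _ (Over.w (D.hat.quotientMk u K' hcov')) ?_
  obtain ⟨e⟩ :=
    A.nonempty_pullback_whiskerLeft_poincareQuotRigid_iso u K hK hcov hG hsm hgc D hfree K' hcov' hG' hsm' hgc' hfree' Φ
  have h := A.baseChangeToProd_quotientMk_left_eq_whiskerLeft_left u D K' hcov' hG' hsm' hgc'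
    (A.quotientBy u K hcov hG hsm hgc)
  dsimp only [DualPair.pullbackP, dualPairOfQuotientRigidified]
  exact ⟨(Scheme.Modules.pullbackCongr h).app _ ≪≫ e⟩

/-- The same in `Over S`: `ψ̂ = (π^∨ as an S-morphism)`. [cite: MumfordAV1970, §15 Thm. 1 (p. 143)] -/
theorem quotientMk_eq_dualIsogenyOver_mulNDesc (h4) :
    (show D.hat.X ⟶ (D.hat.quotientBy u K' hcov' hG' hsm' hgc').X from D.hat.quotientMk u K' hcov') =
      @DualPair.dualIsogenyOver S (A.quotientBy u K hcov hG hsm hgc) A (A.mulNDesc u K hK hcov)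
        (A.isMonHom_mulNDesc u K hK hcov hG hsm hgc hfree)
        (A.dualPairOfQuotientRigidified u K hK hcov hG hsm hgc D hfree K' hcov' hG' hsm' hgc' hfree' Φ h4) D :=
  Over.OverMorphism.ext
    (A.quotientMk_left_eq_dualIsogeny_mulNDesc u K hK hcov hG hsm hgc D hfree K' hcov' hG' hsm' hgc' hfree' Φ h4)

end AbelianSchemeOver

end Literature.AlgebraicGeometry.AbelianSchemes

end
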